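import Literature.Claims.NS.ClayVariants
import Literature.Claims.NS.ClayR3BKMBridge
import Literature.Claims.NS.ClayPeriodicSerrinBridge
import Literature.Claims.NS.ClayPeriodicPressureBridge
import Literature.Analysis.FluidPDE.ClassicalSolution
import Literature.Analysis.FluidPDE.VectorCalculus
import HarnessLib

/-!
# Claim skeleton (D-0090 NS-CLAIMS, C36): Polihronov 2025 — «Well-posed Self-Similarity in
# Incompressible Standard Flows» (global regularity by embedding into a self-similar family)

Typed skeleton of J. Polihronov, *Well-posed Self-Similarity in Incompressible Standard Flows*,
arXiv:2504.21000 [math.GM] **v4** (2025-05-23, 18 pp.; byte-identical PDF = Zenodo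
doi:10.5281/zenodo.15658242 v4) = bib `Polihronov2025SelfSimilar`, the version of record pinned by
cell `ns-claims` (ns-claims-lit-4, `run/shared/lean/pub/ns-claims/sources/Polihronov2025/LOCATORS.md`;
print page = PDF page of v4; TeX labels quoted from `arxiv/2504.21000v4-2025-05-23.tex`). UNREFEREED
CLAIM under adjudication — NOTHING in this file asserts a step of the paper: the paper's statements are
`def … : Prop`; the only `theorem`s are unfolding lemmas of the definitions `ssFamily` / `memberProfile`,
a projection between the two bound predicates, the kernel composition of the paper's OWN implications
(`claim_of_steps`) and the Clay link (`clay_of_claimed`, `clayB_of_claimed`). Verdict vocabulary is the refuter's / referee's.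

## The claimed statement, as printed
**Theorem 3.1 (Global Regularity via Self-Similarity), p.5.** «Let u₀(x,y,z) be any smooth,
divergence-free, space-periodic initial datum or such of Schwartz-class. Then there exists a unique,
self-similar solution u_SS(x,y,z,t) = T^{(β_x−β_t)/β_t} F(x/L₁, y/L₂, z/L₃, t/T), which coincides with
the NSE evolution of u₀ on [0,∞), remains C^∞ for all t ≥ 0, and has all velocity, energy, and
vorticity norms uniformly bounded.» It is the summary of **Theorem A.1 p.6** (space-periodic data:
«the incompressible NSE will always yield an infinitely differentiable, space-periodic, smooth solution
u*(x,y,z,t), such that u*(x,y,z,0) = u₀(x,y,z). The solution u*(x,y,z,t) is not subject to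
scaling-induced blowup for all time, thus ensuring bounded energy of the system in (ℝ³ × [0,∞)). … To
yield the desired results, the self-similar functions must have non-standard isobaric weight β_x − β_t,
where β_x/β_t > 3/2.»), **Theorem B.1 p.8** (the same for Schwartz-class data) and **Corollary B.2
p.10** (data `u₀ ∈ C^∞(ℝ³) ∩ L²(ℝ³)`, `∇·u₀ = 0` ⇒ `u* ∈ C^∞(ℝ³ × [0,∞))` «with uniformly bounded
energy»). Setting (p.1–4): the unforced NSE with constant viscosity `ν > 0` («standard flow
conditions» `α_x = 1, α_t = 2` in the scaling group (1.1): `x′ = kx, t′ = k²t, u′ = k⁻¹u, ν′ = ν`);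
(1.4) the «self-similar solutions» `u = T^{(α_x−α_t)/α_t} F(x/L₁, y/L₂, z/L₃, t/T)` whose parameters
`T, Lᵢ` «rescale as t, x» while `F` has weight zero.

TYPED (`ClaimedTheorem`): the Schwartz-class conjunct over the tree's Clay (A) vocabulary (data (4)
`HasRapidSpatialDecay` = Schwartz for `C^∞` fields, `ClayVariants` §3 Δ4; solutions `C^∞` on
`ℝ³ × [0,∞)` with bounded energy (7)) and the periodic conjunct over the Clay (B) vocabulary at the
unit lattice `ℤ³` (a sub-case of the printed «space-periodic», rectangular periods (A.4) p.7; `u(t)`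
AND `p(t)` periodic = the CMI-errata class, which the paper's own pressure construction App. D.4 p.14
«Δp = −∇·((u·∇)u) … will be smooth and periodic» delivers, and which for `f ≡ 0` is EQUIVALENT to
the printed (B) by `ClayVariants.clayPeriodicErrata_regularity_imp_printed` /
`ClayPeriodicPressureBridge.clayPeriodicErrata_regularity_iff`), each WITH the printed riders: the
solution is «the k = 1 member of a self-similar family (1.4) with β_x/β_t > 3/2» (`IsEmbedded`) and
has velocity and vorticity uniformly bounded on `ℝ³ × [0,∞)` (`UniformlyBounded`; energy: (7), resp.
bounded per period cell as a consequence of the velocity bound). The uniqueness clause is classical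
(smooth finite-energy / periodic solutions) and is not typed inside `ClaimedTheorem` (pressure
constants would make a literal `∃!` false for a reason foreign to the paper); it is not where the claim
bears on Clay, and the kernel composition below does not consume it (see Step 2).

## Delta to Clay (`ClayVariants` §3)
Δ1 `ℝ³` (B.1) / periodic (A.1) = (A)/(B) · Δ2 NSE, `ν > 0` constant = · Δ3 `f ≡ 0` = · Δ4 Schwartz =
(4); smooth periodic = (8); Cor B.2 `C^∞ ∩ L²` wider (good direction) · Δ5 classical on `[0,∞)`, energy
(7) / periodic (10)+errata = · Δ6 conclusion = (A)/(B) plus riders (embedding — trivially satisfiable,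
`ssFamily_one`; uniform bounds — extra content) · Δ7 every `ν > 0` = · Δ8 n/a. NO wrong-problem axis:
`clay_of_claimed : ClaimedTheorem → clayR3.Regularity ∧ clayPeriodicErrata.Regularity` and
`clayB_of_claimed : ClaimedTheorem → NavierStokesExistenceSmoothPeriodic` are PROVED (projections).
The distance to Clay is inside the proof.

## Ordered Step index (the five bullets of the proof of Thm 3.1 p.5 = the sentences of the proofs of
## Thm A.1 pp.6–8 / Thm B.1 pp.8–10 / Cor B.2 pp.10–11; `claim_of_steps` takes them in this order)
* Step 1 = `Lemma12` — Lemma 1.2 p.3 / Corollary 1.3 p.4 / bullet 1 «Embedding of the initial data»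
  p.5 / (A.5) p.7, (B.4) p.9, p.8 l.22 «U u* = Uφ|_{k=1}»: every field (datum or solution) is the
  `k = 1` member of the self-similar family (1.4) — for EVERY isobaric exponent.
* Step 2 = `LocalExistence` — bullet 2 «Existence and uniqueness» p.5 / (A.6)–(A.7) p.7 / (B.5)–(B.6)
  pp.9–10 («It is well known that … one can always construct an unique, infinitely differentiable …
  NSE solution … which exists in the time interval [0,τ)» [1],[11]–[15]).
* Step 3 = `Lemma11` — Lemma 1.1 p.3 with its proof (the three rescaling exponents
  `(2β_x−3β_t)/β_t`, `(4β_x−β_t)/β_t`, `2(β_x−β_t)/β_t` of vorticity, energy, velocity under the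
  standard-flow rescaling of the parameters; «All three exponents will be positive, if β_x/β_t > 3/2»);
  Appendix F p.17 Table 1.
* Step 4 = `UniformBounds` — bullet 3 «A priori norm estimates» p.5: «Lemma 1.1 … shows that for
  β_x/β_t > 3/2, none of these norms grows with the scaling parameter, **yielding uniform bounds for all
  t**» = Thm A.1 proof p.8 l.29–32 («… remain smooth for all time according to the Beale-Kato-Majda
  criterion [16], as shown in Lemma 1.1. The self-similar solutions (A.1) do not exhibit scaling-induced
  blow-up of the vorticity, the energy or the velocity. It follows, that the energy of such solutions
  will remain bound for all time») = Thm B.1 proof p.10 l.43–45 = Cor B.2 p.10 / proof p.11 («Lemma 1.1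
  provides uniform bounds on the vorticity and energy norms»). IMPLICIT as a lemma: it is a proof
  sentence; typed at the level the argument CONSUMES it (the NS-level uniform bound fed to BKM and to
  the theorem's rider), and — cell TYPING-HYGIENE 13 / F15 — at the ABSTRACT GRAIN of the printed
  inference as the companion `UniformBoundsAbs` (from «the k-exponent of the norm is positive» to «the
  norm is bounded uniformly in t»; no printed reduction ⇒ no glue lemma). This is the sentence every
  version of the theorem consumes (LOCATORS §3 L2).
* Step 5 = `BlowupExclusion` — bullet 4 «Blow-up exclusion» p.5 («The classical Beale–Kato–Majda
  criterion [16] is applied: since ∫₀ᵀ ‖ω(·,τ)‖dτ < ∞ by the uniform bound on ‖ω‖, no finite-time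
  singularity can occur. This establishes smoothness of u_SS on [0,∞)») = p.8 l.35–37 («Since Uφ is
  globally smooth, it follows that U u* remains smooth throughout ℝ³ × [0,∞)») = p.10 l.46–48.
COMPOSITION: proved as `claim_of_steps : Lemma12 → LocalExistence → Lemma11 → UniformBoundsAbs →
UniformBounds → BlowupExclusion → ClaimedTheorem`; the kernel consumes Steps 1, 2, 4, 5 (Step 3 and
the abstract companion are the printed JUSTIFICATION of Step 4 — bullet 3 cites Lemma 1.1 and nothing
else — and enter as unused binders, MAP-SCHEMA §1b: load-bearing = `UniformBounds`).

## References
* J. Polihronov, arXiv:2504.21000v4 (`Polihronov2025SelfSimilar`): (1.1)–(1.4) pp.2–3, Lemma 1.1 /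
  Lemma 1.2 p.3, Cor 1.3 p.4, §2 p.4, Thm 3.1 + proof p.5, §4 pp.5–6, App. A Thm A.1 pp.6–8
  ((A.1)–(A.7)), App. B Thm B.1 pp.8–10 ((B.1)–(B.6)), Cor B.2 pp.10–11, App. C–E pp.11–17 (examples),
  App. F p.17 (Table 1), references p.18 ([16] = Beale–Kato–Majda 1984).
* Background [2] = J. Polihronov, AIP Advances 12 (2022) 085022 = arXiv:1902.01985v7
  (`Polihronov2022Bouton`), not used here.
* Cell files: `claims/Polihronov2025/CARD.md` (typist-1 g2, PREDICTION 2026-08-27T00:04:32Z),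
  `sources/Polihronov2025/LOCATORS.md` (lit-4).

WHAT THIS IS NOT: not a claim about NS regularity or blow-up; not a claim about any author beyond the
typed locator.
-/

noncomputable section

open Set
open scoped ContDiff ENNReal

namespace Literature.Claims.NS.Polihronov2025

open Literature.Analysis.FluidPDE

/-! ## Carriers, the self-similar family (1.4) and the printed classes -/

/-- Physical space `ℝ³`. [folklore] -/
abbrev E3 : Type := EuclideanSpace ℝ (Fin 3)

/-- **The one-parameter self-similar family (1.4) generated by its `k = 1` member `v`, isobaric
exponent `γ = (β_x − β_t)/β_t`, under standard flow conditions `α_x = 1, α_t = 2`.** In (1.4)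
`u = T^γ F(x/L₁, y/L₂, z/L₃, t/T)` the parameters rescale as `T ↦ k²T`, `Lᵢ ↦ kLᵢ` while `F` (weight
zero) does not (p.3 after (1.4); §2 p.4; Thm A.1 proof p.6 after (A.1): «L₁, L₂, L₃, T, U are nonzero
parameters that scale the same way as x, y, z, t, u»); hence the `k`-th member is
`u_k(t, x) = k^{2γ} · v(t/k², x/k)` where `v = T^γ F(x/L, t/T)` is the `k = 1` member — Lemma 1.1's
proof: «u*′ = k^{2(β_x−β_t)/β_t} u*» at corresponding points `(k²t, kx) ↔ (t, x)`. (Intended for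
`0 < k`; `k ^ (2γ)` is the real power.) [cite: Polihronov2025SelfSimilar, (1.4) p.3; Lemma 1.1 proof p.3; (A.1) p.6; App. D–F pp.13–17] -/
def ssFamily (γ : ℝ) (v : ℝ → E3 → E3) (k : ℝ) : ℝ → E3 → E3 :=
  fun t x => (k ^ (2 * γ)) • v (t / k ^ 2) (k⁻¹ • x)

/-- The `k = 1` member of the family generated by `v` is `v` itself — for EVERY exponent `γ`
(«at the identity scale», Lemma 1.2 p.3: «it follows that k = 1, or a = 0, which is the trivial, or
identity scaling»). [cite: Polihronov2025SelfSimilar, Lemma 1.2 p.3; (A.5) p.7] -/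
@[simp]
theorem ssFamily_one (γ : ℝ) (v : ℝ → E3 → E3) : ssFamily γ v 1 = v := by
  funext t x
  simp [ssFamily]

/-- Lemma 1.1's velocity law, by unfolding: at corresponding points the `k`-th member is `k^{2γ}`
times the `k = 1` member, `u_k(k²t, kx) = k^{2γ} v(t, x)` («u*′ = k^{2(β_x−β_t)/β_t} u*»).
[cite: Polihronov2025SelfSimilar, Lemma 1.1 proof p.3] -/
theorem ssFamily_apply_scaled (γ : ℝ) (v : ℝ → E3 → E3) {k : ℝ} (hk : 0 < k) (t : ℝ) (x : E3) :
    ssFamily γ v k (k ^ 2 * t) (k • x) = (k ^ (2 * γ)) • v t x := by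
  have hk0 : k ≠ 0 := hk.ne'
  simp [ssFamily, smul_smul, hk0]

/-- «Embedded at the identity scale in a self-similar family (1.4) of isobaric weight β_x − β_t with
β_x/β_t > 3/2»: `u` is the `k = 1` member of `ssFamily (r − 1) u` for some `r = β_x/β_t > 3/2`
(`γ = (β_x − β_t)/β_t = r − 1`). The rider of Thm 3.1 p.5 («there exists a unique, self-similar
solution u_SS = T^{(β_x−β_t)/β_t} F(…) which coincides with the NSE evolution of u₀») and the
hypothesis under which bullets 3–4 are applied. [cite: Polihronov2025SelfSimilar, Thm 3.1 p.5; Cor 1.3 p.4; Thm A.1 p.6; Cor B.2 p.10] -/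
def IsEmbedded (u : ℝ → E3 → E3) : Prop :=
  ∃ r : ℝ, 3 / 2 < r ∧ ssFamily (r - 1) u 1 = u

/-- Schwartz-class datum (Thm B.1 p.8; Thm 3.1 p.5 «smooth, divergence-free … of Schwartz-class»):
smooth, divergence-free, all derivatives rapidly decreasing = Clay (4).
[cite: Polihronov2025SelfSimilar, Thm B.1 p.8; (B.3) p.9] -/
def IsSchwartzDatum (u₀ : E3 → E3) : Prop :=
  ContDiff ℝ ∞ u₀ ∧ NSWave0.IsDivFree u₀ ∧ HasRapidSpatialDecay u₀

/-- Space-periodic datum (Thm A.1 p.6; (A.4) p.7), typed at the unit lattice `ℤ³` = Clay (8): smooth,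
divergence-free, lattice-periodic. [cite: Polihronov2025SelfSimilar, Thm A.1 p.6; (A.4) p.7] -/
def IsPeriodicDatum (u₀ : E3 → E3) : Prop :=
  ContDiff ℝ ∞ u₀ ∧ NSWave0.IsDivFree u₀ ∧ IsLatticePeriodic u₀

/-- The print's LOCAL solution class, Schwartz setting: a classical solution `(u, p)` of the unforced
NSE on `ℝ³ × S` (`S = [0,τ)`: bullet 2 p.5 «a unique, smooth NSE solution (u,p) on an interval
[0,τ)», «Leray–Hopf theory in the Schwartz-class setting»; (B.6) p.10) issued from a Schwartz-class
datum and of finite energy on `S` (Cor B.2 p.10 «finite-energy»; p.8 l.32 «the energy of such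
solutions will remain bound»). Finite energy is part of the printed class; it also keeps the Galilean
/ spatially constant parasitic solutions (infinite energy) out of the typed class (cell ROUTE 5b, F3).
[cite: Polihronov2025SelfSimilar, Thm 3.1 proof bullet 2 p.5; (B.6) p.10; Cor B.2 p.10] -/
structure IsLocalSchwartzSolution (S : Set ℝ) (ν : ℝ) (u : ℝ → E3 → E3) (p : ℝ → E3 → ℝ) :
    Prop where
  classical : IsClassicalNSSolutionOn S ν 0 u p
  datum : HasRapidSpatialDecay (u 0)
  energy : ∃ C : ℝ≥0∞, C < ⊤ ∧ ∀ t ∈ S, ∫⁻ x, ‖u t x‖ₑ ^ 2 ≤ C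

/-- The print's LOCAL solution class, periodic setting: a classical solution `(u, p)` of the unforced
NSE on `ℝ³ × S` with `u(t)` and `p(t)` lattice-periodic (bullet 2 p.5 «Kato–Fujita theory in the
periodic setting»; (A.6)–(A.7) p.7 «space-periodic … NSE solution … in the time interval [0,τ)»; the
pressure of App. D.4 p.14 is periodic). [cite: Polihronov2025SelfSimilar, Thm 3.1 proof bullet 2 p.5; (A.7) p.7; App. D.4 p.14] -/
structure IsLocalPeriodicSolution (S : Set ℝ) (ν : ℝ) (u : ℝ → E3 → E3) (p : ℝ → E3 → ℝ) :
    Prop where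
  classical : IsClassicalNSSolutionOn S ν 0 u p
  periodic_velocity : ∀ t ∈ S, IsLatticePeriodic (u t)
  periodic_pressure : ∀ t ∈ S, IsLatticePeriodic (p t)

/-- The GLOBAL solution the theorems assert, Schwartz setting, in Clay vocabulary: `u, p ∈
C^∞(ℝ³ × [0,∞))`, (1)(2)(3) with `f ≡ 0` and datum `u₀`, bounded energy (7) (Thm B.1 p.8 «infinitely
differentiable … smooth solution … ensuring bounded energy of the system in ℝ³ × [0,∞)»; Cor B.2
p.10 «u* ∈ C^∞(ℝ³ × [0,∞)) with uniformly bounded energy»). [cite: Polihronov2025SelfSimilar, Thm B.1 p.8; Cor B.2 p.10] -/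
structure IsGlobalSchwartzSolution (ν : ℝ) (u₀ : E3 → E3) (u : ℝ → E3 → E3) (p : ℝ → E3 → ℝ) :
    Prop where
  smooth_velocity : IsSmoothOnHalfSpace u
  smooth_pressure : IsSmoothOnHalfSpace p
  solves : IsNavierStokesSolution ν 0 u₀ u p
  energy : HasBoundedEnergy u

/-- The GLOBAL solution the theorems assert, periodic setting, in Clay vocabulary: `u, p ∈
C^∞(ℝ³ × [0,∞))`, (1)(2)(3) with `f ≡ 0` and datum `u₀`, `u(t)` and `p(t)` lattice-periodic for
`t ≥ 0` (Thm A.1 p.6 «an infinitely differentiable, space-periodic, smooth solution u*(x,y,z,t), such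
that u*(x,y,z,0) = u₀»). [cite: Polihronov2025SelfSimilar, Thm A.1 p.6] -/
structure IsGlobalPeriodicSolution (ν : ℝ) (u₀ : E3 → E3) (u : ℝ → E3 → E3) (p : ℝ → E3 → ℝ) :
    Prop where
  smooth_velocity : IsSmoothOnHalfSpace u
  smooth_pressure : IsSmoothOnHalfSpace p
  solves : IsNavierStokesSolution ν 0 u₀ u p
  periodic : ∀ t : ℝ, 0 ≤ t → IsLatticePeriodic (u t) ∧ IsLatticePeriodic (p t)

/-- «All velocity … and vorticity norms uniformly bounded» on a time set `S` (Thm 3.1 p.5; Thm A.1 p.6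
«not subject to scaling-induced blowup for all time»), typed without suprema (cell TYPING-HYGIENE 1):
ONE constant bounds `|u(t,x)|` and `|ω(t,x)|`, `ω = curl u`, for all `t ∈ S`, `x ∈ ℝ³`. (Energy: in the
Schwartz setting it is the separate clause (7); in the periodic setting the energy per period cell is
at most `M²` by the velocity bound.) [cite: Polihronov2025SelfSimilar, Thm 3.1 p.5; Thm A.1 p.6; Lemma 1.1 p.3] -/
def UniformlyBoundedOn (S : Set ℝ) (u : ℝ → E3 → E3) : Prop :=
  ∃ M : ℝ, ∀ t ∈ S, ∀ x : E3, ‖u t x‖ ≤ M ∧ ‖curl (u t) x‖ ≤ M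

/-- «The uniform bound on ‖ω‖» that bullet 4 p.5 feeds to the Beale–Kato–Majda criterion («since
∫₀ᵀ ‖ω(·,τ)‖dτ < ∞ by the uniform bound on ‖ω‖»): one constant bounds `|curl u(t,x)|` for `t ∈ S`,
`x ∈ ℝ³` (no suprema, cell TYPING-HYGIENE 1). [cite: Polihronov2025SelfSimilar, Thm 3.1 proof bullet 4 p.5] -/
def VorticityBoundedOn (S : Set ℝ) (u : ℝ → E3 → E3) : Prop :=
  ∃ M : ℝ, ∀ t ∈ S, ∀ x : E3, ‖curl (u t) x‖ ≤ M

/-- The uniform velocity-and-vorticity bound gives the vorticity bound. [cite: Polihronov2025SelfSimilar, Thm 3.1 proof bullets 3–4 p.5] -/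
theorem UniformlyBoundedOn.vorticity {S : Set ℝ} {u : ℝ → E3 → E3} (h : UniformlyBoundedOn S u) :
    VorticityBoundedOn S u := by
  obtain ⟨M, hM⟩ := h
  exact ⟨M, fun t ht x => (hM t ht x).2⟩

/-! ## The claimed theorem -/

/-- **CLAIMED THEOREM** (Theorem 3.1 p.5 = Theorem B.1 p.8 ∧ Theorem A.1 p.6, with the printed
riders): for every `ν > 0`, (i) every Schwartz-class divergence-free datum has a global smooth
finite-energy solution of the unforced NSE on `ℝ³ × [0,∞)` which is the `k = 1` member of a
self-similar family (1.4) with `β_x/β_t > 3/2` and whose velocity and vorticity are bounded uniformly on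
`ℝ³ × [0,∞)`; (ii) the same for every smooth divergence-free `ℤ³`-periodic datum, with `u(t)`, `p(t)`
periodic. [claim: Polihronov2025SelfSimilar, status: under-review] [cite: Polihronov2025SelfSimilar, Thm 3.1 p.5; Thm A.1 p.6; Thm B.1 p.8; Cor B.2 p.10] -/
def ClaimedTheorem : Prop :=
  ∀ ν : ℝ, 0 < ν →
    (∀ u₀ : E3 → E3, IsSchwartzDatum u₀ →
      ∃ (u : ℝ → E3 → E3) (p : ℝ → E3 → ℝ),
        IsGlobalSchwartzSolution ν u₀ u p ∧ IsEmbedded u ∧ UniformlyBoundedOn (Ici 0) u) ∧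
    (∀ u₀ : E3 → E3, IsPeriodicDatum u₀ →
      ∃ (u : ℝ → E3 → E3) (p : ℝ → E3 → ℝ),
        IsGlobalPeriodicSolution ν u₀ u p ∧ IsEmbedded u ∧ UniformlyBoundedOn (Ici 0) u)

/-! ## The Steps of the printed argument (Thm 3.1 proof p.5, bullets 1–4) -/

/-- **Step 1 — Lemma 1.2 p.3 / Corollary 1.3 p.4 / bullet 1 «Embedding of the initial data» p.5.**
«Any function f(x,y,z) is contained, or embedded in the self-similar function p₄ f(x/p₁, y/p₂, z/p₃)
at the identity scale» / «Any non-self-similar solution f(x,y,z,t) of the NSE is contained, or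
embedded in the self-similar solution … at the identity scale» / «u₀ is realized as the k = 1 member
of a one-parameter self-similar family u_SS = T^{(β_x−β_t)/β_t} F(x/L₁, y/L₂, z/L₃, t/T)»; used again
at (A.5) p.7, p.8 l.22 («U u* = Uφ|_{k=1}»), (B.4) p.9, p.10 l.35. Typed: every field is the `k = 1`
member of the family (1.4) it generates, for every isobaric exponent `γ` (so in particular for every
`β_x/β_t > 3/2`). [claim: Polihronov2025SelfSimilar, status: under-review] [cite: Polihronov2025SelfSimilar, Lemma 1.2 p.3; Cor 1.3 p.4; Thm 3.1 proof bullet 1 p.5; (A.5) p.7; (B.4) p.9] -/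
def Lemma12 : Prop :=
  ∀ (γ : ℝ) (v : ℝ → E3 → E3), ssFamily γ v 1 = v

/-- **Step 2 — bullet 2 «Existence and uniqueness» p.5** («Invoking the Kato–Fujita theory in the
periodic setting (or Leray–Hopf theory in the Schwartz-class setting) [1], [11]-[15], one obtains a
unique, smooth NSE solution (u,p) on an interval [0,τ) with u(x,y,z,0) = u₀»; (A.6)–(A.7) p.7 and
(B.5)–(B.6) pp.9–10: «It is well known that, given a smooth … initial condition …, one can always
construct an unique, infinitely differentiable … NSE solution … which exists in the time interval
[0,τ)»). Typed: LOCAL EXISTENCE in the print's classes (classical local theory). The printed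
uniqueness clause («By uniqueness, this solution must coincide with the self-similar field u_SS»)
is not typed: `u_SS|_{k=1}` is `u` itself by Step 1, so the kernel composition does not consume
uniqueness. [claim: Polihronov2025SelfSimilar, status: under-review] [cite: Polihronov2025SelfSimilar, Thm 3.1 proof bullet 2 p.5; (A.6)–(A.7) p.7; (B.5)–(B.6) pp.9–10] -/
def LocalExistence : Prop :=
  ∀ ν : ℝ, 0 < ν →
    (∀ u₀ : E3 → E3, IsSchwartzDatum u₀ →
      ∃ τ : ℝ, 0 < τ ∧ ∃ (u : ℝ → E3 → E3) (p : ℝ → E3 → ℝ),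
        IsLocalSchwartzSolution (Ico 0 τ) ν u p ∧ u 0 = u₀) ∧
    (∀ u₀ : E3 → E3, IsPeriodicDatum u₀ →
      ∃ τ : ℝ, 0 < τ ∧ ∃ (u : ℝ → E3 → E3) (p : ℝ → E3 → ℝ),
        IsLocalPeriodicSolution (Ico 0 τ) ν u p ∧ u 0 = u₀)

/-- **Step 3 — Lemma 1.1 p.3** («When the self-similar solution (1.4) u* = T^{(β_x−β_t)/β_t} F(x/L₁,
y/L₂, z/L₃, t/T) with isobaric weight β_x − β_t rescales in standard flow conditions where α_x = 1,
α_t = 2, the solution is not subject to scaling induced blowup of the velocity, the energy or the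
vorticity as long as β_x/β_t > 3/2»), typed with its three-line proof, which IS its content:
«(∂u*/∂x)′ = k^{(2β_x−3β_t)/β_t} (∂u*/∂x)», «E′ = k^{(4β_x−β_t)/β_t} E», «u*′ = k^{2(β_x−β_t)/β_t} u*»,
«All three exponents will be positive, if β_x/β_t > 3/2» — with `r = β_x/β_t` the exponents are
`2r − 3`, `4r − 1`, `2(r − 1)` (App. F p.17, Table 1). (The velocity law is `ssFamily_apply_scaled`;
the derivative and energy laws follow by the chain rule and the change of variables `x′ = kx`.)
[claim: Polihronov2025SelfSimilar, status: under-review] [cite: Polihronov2025SelfSimilar, Lemma 1.1 + proof p.3; App. F Table 1 p.17] -/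
def Lemma11 : Prop :=
  ∀ r : ℝ, 3 / 2 < r → 0 < 2 * r - 3 ∧ 0 < 4 * r - 1 ∧ 0 < 2 * (r - 1)

/-- The time profile of a norm of the `k`-th member of the family, given the profile `n` of the
`k = 1` member and the `k`-exponent `e` of that norm from Lemma 1.1 (`e = 2r − 3` vorticity,
`2(r − 1)` velocity, `4r − 1` energy): `N_k(s) = k^e · n(s/k²)` — i.e. `N_k(k²t) = k^e n(t)`
(«(∂u*/∂x)′ = k^{(2β_x−3β_t)/β_t}(∂u*/∂x)» etc., read at corresponding times `t′ = k²t`).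
[cite: Polihronov2025SelfSimilar, Lemma 1.1 proof p.3; App. F p.17 «‖ω_k‖ ∼ k^{(2β_x−3β_t)/β_t}, ‖u_k‖ ∼ k^{2(β_x−β_t)/β_t}, E_k ∼ k^{(4β_x−β_t)/β_t}»] -/
def memberProfile (e : ℝ) (n : ℝ → ℝ) (k : ℝ) : ℝ → ℝ :=
  fun s => k ^ e * n (s / k ^ 2)

/-- Lemma 1.1's law, read on time profiles, holds for EVERY profile `n` and exponent `e`: the `k`-th
member's profile at the corresponding time `k²t` is `k^e` times the `k = 1` profile at `t` (unfolding
`memberProfile`). [cite: Polihronov2025SelfSimilar, Lemma 1.1 proof p.3] -/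
theorem memberProfile_apply_scaled (e : ℝ) (n : ℝ → ℝ) {k : ℝ} (hk : 0 < k) (t : ℝ) :
    memberProfile e n k (k ^ 2 * t) = k ^ e * n t := by
  have hk2 : k ^ 2 ≠ 0 := pow_ne_zero 2 hk.ne'
  simp only [memberProfile, mul_div_cancel_left₀ t hk2]

/-- **Step 4 (abstract grain of the same sentence; cell TYPING-HYGIENE 13 / F15) — bullet 3 p.5:
«Lemma 1.1 provides exact scaling exponents for the velocity, energy and vorticity norms under the
standard flow scaling (α_x = 1, α_t = 2). It shows that for β_x/β_t > 3/2, none of these norms grows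
with the scaling parameter, yielding uniform bounds for all t»; Cor B.2 p.10 «Lemma 1.1 then shows
that under the standard scaling no velocity, energy, or vorticity norm grows with k»; App. F p.17 «the
vorticity exponent 2β_x − 3β_t > 0 indicates decrease at fine scales … In such regimes the combined
energy and vorticity control … guarantees no finite-time blowup».** The printed inference, over the
reals: let `n : [0,∞) → [0,∞)` be the time profile, at the identity scale `k = 1`, of one of the three
norms of the self-similar solution, and `e ∈ {2r − 3, 2(r − 1), 4r − 1}` its `k`-exponent from
Lemma 1.1 (`r = β_x/β_t > 3/2`, so `e > 0`: «none of these norms grows with the scaling parameter» —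
the `k`-th member's profile is `k^e n` at corresponding times); CONCLUSION «uniform bounds for all
t»: `n` is bounded on `[0,∞)`. No reduction of the NS-level Step 4 to this statement is printed (the
sentence IS the reduction), so no glue lemma is offered; both typings carry the same locator.
[claim: Polihronov2025SelfSimilar, status: under-review] [cite: Polihronov2025SelfSimilar, Thm 3.1 proof bullet 3 p.5; Thm A.1 proof p.8 l.29–32; Cor B.2 p.10 and proof p.11; App. F p.17] -/
def UniformBoundsAbs : Prop :=
  ∀ r : ℝ, 3 / 2 < r →
    ∀ n : ℝ → ℝ, (∀ t : ℝ, 0 ≤ t → 0 ≤ n t) →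
      ∀ e : ℝ, (e = 2 * r - 3 ∨ e = 2 * (r - 1) ∨ e = 4 * r - 1) →
        (∀ k t : ℝ, 0 < k → 0 ≤ t → memberProfile e n k (k ^ 2 * t) = k ^ e * n t) →
          ∃ M : ℝ, ∀ t : ℝ, 0 ≤ t → n t ≤ M

/-- **Step 4 — bullet 3 «A priori norm estimates» p.5 AS THE ARGUMENT CONSUMES IT** (= Thm A.1 proof
p.8 l.29–32 «The self-similar solutions (A.1) have isobaric weight β_x − β_t with β_x/β_t > 3/2; but
rescaled under standard conditions α_x = 1, α_t = 2 remain smooth for all time according to the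
Beale-Kato-Majda criterion [16], as shown in Lemma 1.1. The self-similar solutions (A.1) do not exhibit
scaling-induced blow-up of the vorticity, the energy or the velocity. It follows, that the energy of
such solutions will remain bound for all time»; Thm B.1 proof p.10 l.43–45; Cor B.2 proof p.11 «Lemma
1.1 provides uniform bounds on the vorticity and energy norms»): every solution of the print's class
(local on `[0,T)`, where bullet 4 feeds the bound to BKM, or global on `[0,∞)`, where it is the
theorem's rider «uniformly bounded»), which is the `k = 1` member of a self-similar family (1.4) with
`β_x/β_t > 3/2`, has velocity and vorticity bounded by one constant on its whole time set — in both
settings. (The embedding hypothesis is supplied by Step 1 for every field.)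
[claim: Polihronov2025SelfSimilar, status: under-review] [cite: Polihronov2025SelfSimilar, Thm 3.1 proof bullet 3 p.5; Thm A.1 proof p.8 l.29–32; Thm B.1 proof p.10 l.43–45; Cor B.2 proof p.11] -/
def UniformBounds : Prop :=
  ∀ ν : ℝ, 0 < ν →
    (∀ T : ℝ, 0 < T → ∀ (u : ℝ → E3 → E3) (p : ℝ → E3 → ℝ),
        IsLocalSchwartzSolution (Ico 0 T) ν u p → IsEmbedded u → UniformlyBoundedOn (Ico 0 T) u) ∧
    (∀ (u₀ : E3 → E3) (u : ℝ → E3 → E3) (p : ℝ → E3 → ℝ), IsSchwartzDatum u₀ →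
        IsGlobalSchwartzSolution ν u₀ u p → IsEmbedded u → UniformlyBoundedOn (Ici 0) u) ∧
    (∀ T : ℝ, 0 < T → ∀ (u : ℝ → E3 → E3) (p : ℝ → E3 → ℝ),
        IsLocalPeriodicSolution (Ico 0 T) ν u p → IsEmbedded u → UniformlyBoundedOn (Ico 0 T) u) ∧
    (∀ (u₀ : E3 → E3) (u : ℝ → E3 → E3) (p : ℝ → E3 → ℝ), IsPeriodicDatum u₀ →
        IsGlobalPeriodicSolution ν u₀ u p → IsEmbedded u → UniformlyBoundedOn (Ici 0) u)

/-- **Step 5 — bullet 4 «Blow-up exclusion» p.5** («The classical Beale–Kato–Majda criterion [16] is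
applied: since ∫₀ᵀ ‖ω(·,τ)‖dτ < ∞ by the uniform bound on ‖ω‖, no finite-time singularity can occur.
This establishes smoothness of u_SS on [0,∞)»; p.8 l.35–37 «Since Uφ is globally smooth, it follows
that U u* remains smooth throughout ℝ³ × [0,∞)»; p.10 l.46–48), typed as the argument uses it in each
setting: given a datum of the class with a local solution (bullet 2), IF every solution of the print's
class from that datum on every finite horizon `[0,T)` has vorticity bounded on `[0,T) × ℝ³` («the
uniform bound on ‖ω‖», the output of bullet 3; hence `∫₀ᵀ ‖ω‖_∞ < ∞`), THEN the datum has a global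
smooth solution of the class on `[0,∞)` (BKM continuation [16] + the standard maximal-time argument,
«no finite-time singularity can occur»). [claim: Polihronov2025SelfSimilar, status: under-review] [cite: Polihronov2025SelfSimilar, Thm 3.1 proof bullet 4 p.5; Thm A.1 proof p.8 l.29–37; Thm B.1 proof p.10 l.43–48; Cor B.2 proof p.11; ref. [16] p.18] -/
def BlowupExclusion : Prop :=
  ∀ ν : ℝ, 0 < ν →
    (∀ u₀ : E3 → E3, IsSchwartzDatum u₀ →
      (∃ τ : ℝ, 0 < τ ∧ ∃ (u : ℝ → E3 → E3) (p : ℝ → E3 → ℝ),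
          IsLocalSchwartzSolution (Ico 0 τ) ν u p ∧ u 0 = u₀) →
      (∀ T : ℝ, 0 < T → ∀ (u : ℝ → E3 → E3) (p : ℝ → E3 → ℝ),
          IsLocalSchwartzSolution (Ico 0 T) ν u p → u 0 = u₀ → VorticityBoundedOn (Ico 0 T) u) →
      ∃ (u : ℝ → E3 → E3) (p : ℝ → E3 → ℝ), IsGlobalSchwartzSolution ν u₀ u p) ∧
    (∀ u₀ : E3 → E3, IsPeriodicDatum u₀ →
      (∃ τ : ℝ, 0 < τ ∧ ∃ (u : ℝ → E3 → E3) (p : ℝ → E3 → ℝ),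
          IsLocalPeriodicSolution (Ico 0 τ) ν u p ∧ u 0 = u₀) →
      (∀ T : ℝ, 0 < T → ∀ (u : ℝ → E3 → E3) (p : ℝ → E3 → ℝ),
          IsLocalPeriodicSolution (Ico 0 T) ν u p → u 0 = u₀ → VorticityBoundedOn (Ico 0 T) u) →
      ∃ (u : ℝ → E3 → E3) (p : ℝ → E3 → ℝ), IsGlobalPeriodicSolution ν u₀ u p)

/-! ## Kernel composition -/

/-- Every field is embedded at the identity scale in a family with `β_x/β_t > 3/2` (Step 1 with
`r = 2`, `γ = 1`). [cite: Polihronov2025SelfSimilar, Thm 3.1 proof bullet 1 p.5] -/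
theorem isEmbedded_of_lemma12 (h₁ : Lemma12) (u : ℝ → E3 → E3) : IsEmbedded u :=
  ⟨2, by norm_num, h₁ (2 - 1) u⟩

/-- **COMPOSITION** (Thm 3.1 proof p.5, bullets 1–5 = Thm A.1 / B.1 proofs): embedding (Step 1) ⇒
local solution (Step 2) ⇒ uniform vorticity/velocity bounds for every solution from the datum on every
finite horizon (Step 4, first/third clause) ⇒ global smooth solution by blow-up exclusion (Step 5) ⇒
the riders by Step 1 and Step 4 (second/fourth clause). Step 3 (Lemma 1.1) and the abstract companion
of Step 4 are the printed justification of Step 4 and are not consumed by the kernel.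
[cite: Polihronov2025SelfSimilar, Thm 3.1 proof p.5 «Conclusion of Theorem 3.1»] -/
theorem claim_of_steps (h₁ : Lemma12) (h₂ : LocalExistence) (_h₃ : Lemma11)
    (_h₄abs : UniformBoundsAbs) (h₄ : UniformBounds) (h₅ : BlowupExclusion) : ClaimedTheorem := by
  intro ν hν
  obtain ⟨h4a, h4b, h4c, h4d⟩ := h₄ ν hν
  refine ⟨fun u₀ hu₀ => ?_, fun u₀ hu₀ => ?_⟩
  · have hloc := (h₂ ν hν).1 u₀ hu₀
    have hbd : ∀ T : ℝ, 0 < T → ∀ (u : ℝ → E3 → E3) (p : ℝ → E3 → ℝ),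
        IsLocalSchwartzSolution (Ico 0 T) ν u p → u 0 = u₀ → VorticityBoundedOn (Ico 0 T) u :=
      fun T hT u p hsol _ => (h4a T hT u p hsol (isEmbedded_of_lemma12 h₁ u)).vorticity
    obtain ⟨u, p, hglob⟩ := (h₅ ν hν).1 u₀ hu₀ hloc hbd
    exact ⟨u, p, hglob, isEmbedded_of_lemma12 h₁ u,
      h4b u₀ u p hu₀ hglob (isEmbedded_of_lemma12 h₁ u)⟩
  · have hloc := (h₂ ν hν).2 u₀ hu₀
    have hbd : ∀ T : ℝ, 0 < T → ∀ (u : ℝ → E3 → E3) (p : ℝ → E3 → ℝ),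
        IsLocalPeriodicSolution (Ico 0 T) ν u p → u 0 = u₀ → VorticityBoundedOn (Ico 0 T) u :=
      fun T hT u p hsol _ => (h4c T hT u p hsol (isEmbedded_of_lemma12 h₁ u)).vorticity
    obtain ⟨u, p, hglob⟩ := (h₅ ν hν).2 u₀ hu₀ hloc hbd
    exact ⟨u, p, hglob, isEmbedded_of_lemma12 h₁ u,
      h4d u₀ u p hu₀ hglob (isEmbedded_of_lemma12 h₁ u)⟩

/-! ## The Clay link (cell TYPING-HYGIENE 10(a)) -/

/-- **CLAY LINK, PROVED**: the claimed theorem implies Clay (A) (`ClayVariants.clayR3.Regularity`)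
and errata-(B) (`ClayVariants.clayPeriodicErrata.Regularity`) by projection — the riders are dropped.
[cite: Polihronov2025SelfSimilar, Thm B.1 p.8; Thm A.1 p.6] -/
theorem clay_of_claimed (h : ClaimedTheorem) :
    ClayVariants.clayR3.Regularity ∧ ClayVariants.clayPeriodicErrata.Regularity := by
  refine ⟨fun ν hν u₀ hu₀ hdiv hdec => ?_, fun ν hν u₀ hu₀ hdiv hper => ?_⟩
  · obtain ⟨u, p, hg, -, -⟩ := (h ν hν).1 u₀ ⟨hu₀, hdiv, hdec⟩
    exact ⟨u, p, hg.smooth_velocity, hg.smooth_pressure, hg.solves, hg.energy⟩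
  · obtain ⟨u, p, hg, -, -⟩ := (h ν hν).2 u₀ ⟨hu₀, hdiv, hper⟩
    exact ⟨u, p, hg.smooth_velocity, hg.smooth_pressure, hg.solves, hg.periodic⟩

/-- The periodic conjunct also gives the PRINTED Clay (B) (conjecture leaf
`NavierStokesExistenceSmoothPeriodic`) through the landed bridge
`ClayVariants.clayPeriodicErrata_regularity_imp_printed`. [cite: Polihronov2025SelfSimilar, Thm A.1 p.6] -/
theorem clayB_of_claimed (h : ClaimedTheorem) :
    Summit.NavierStokesRegularity.NavierStokesRegularity.NavierStokesExistenceSmoothPeriodic :=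
  ClayVariants.clayPeriodicErrata_regularity_imp_printed (clay_of_claimed h).2

/-! ## Step 5 PROVED (D-0026 debt pass of the cell's idle default, v1.31h; typist-1 g5, CARD custodian
C36). APPEND-ONLY: no statement above is changed; verdict #46 (locator `UniformBoundsAbs`, false lemma
by `…Theorems.Polihronov2025.not_UniformBoundsAbs` p480514) is untouched. -/

section DebtPass

/-- **Step 5 HOLDS (kernel)** — the blow-up exclusion of Thm 3.1 proof bullet 4 p.5 / Thm A.1 proof
p.8 l.29–37 / Thm B.1 proof p.10 l.43–48 / Cor B.2 proof p.11 («By the Beale–Kato–Majda criterion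
[16] … since ∫₀ᵀ ‖ω(·,τ)‖dτ < ∞ by the uniform bound on ‖ω‖, no finite-time singularity can occur»),
as typed: IF every solution of the print's local class from the datum on every `[0, T)` has bounded
vorticity, THEN the datum has a global Clay-sense solution — TRUE, in both settings, by the tree's
DISCHARGED blow-up alternatives and BKM doors (the paper's ref. [16]):
* Schwartz setting (`ℝ³`, Clay (A) class): `ClayVariants.clayR3_solvable_or_supBlowup` gives either a
  Clay solution or a maximal finite-energy classical solution on `[0, T*)`; the latter is in the
  Beale–Kato–Majda class on closed sub-slabs (`ClayVariants.hasBoundedSobolevNormsOn_Icc_of_finiteEnergy_Ico`,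
  Tao 2013 Cor. 11.1), its vorticity is bounded on `[0, T*) × ℝ³` by the hypothesis (it IS a solution of
  the print's local class: classical, datum of class (4), finite energy), so its BKM integral is `≤ M T*`
  and `beale_kato_majda_holds` (Beale–Kato–Majda 1984 Thm. 1) continues it in the Sobolev class past
  `T*` — the continuation restricted to `[0, T*]` contradicts maximality;
* periodic setting (errata-(B) class): the per-datum torus BKM door
  `ClayVariants.clayPeriodic_solvable_of_aprioriCurlBound_datum` (printed (10)) and the pressure
  normalisation `ClayVariants.clayPeriodic_solvable_zero_iff_errata` (Tao 2013 Lemma 4.1 (ii): `p(t)`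
  periodic too).
The local-existence antecedent of the Step is not needed. Net Literature debt −1; kernel status of the
skeleton afterwards: Steps 1, 3 TRUE Summits-side, Step 2 classical (Summits-side twin), Step 4
`UniformBoundsAbs` FALSE (locator) / `UniformBounds` summit-strength, Step 5 TRUE.
[cite: Polihronov2025SelfSimilar, Thm 3.1 proof bullet 4 p.5; Thm A.1 proof p.8 l.29–37; Thm B.1 proof p.10 l.43–48; ref. [16] p.18]
[cite: BealeKatoMajda1984, Thm. 1 and Corollary] [cite: Tao2011, Cor. 11.1 and Lemma 4.1 (ii) (arXiv:1108.1165)] -/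
theorem blowupExclusion_holds : BlowupExclusion := by
  intro ν hν
  refine ⟨fun u₀ hu₀ _ hbd => ?_, fun u₀ hu₀ _ hbd => ?_⟩
  · -- Schwartz setting
    obtain ⟨hsm, hdiv, hdec⟩ := hu₀
    rcases ClayVariants.clayR3_solvable_or_supBlowup hν hsm hdiv hdec with
      ⟨u, p, hu, hp, hns, hE⟩ | ⟨Ts, hTs, u, p, hcl, hu0, hE, -, hmax⟩
    · exact ⟨u, p, ⟨hu, hp, hns, hE⟩⟩
    · exfalso
      -- `u` is a solution of the print's local class on `[0, T*)` from `u₀`: its vorticity is bounded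
      have hloc : IsLocalSchwartzSolution (Ico 0 Ts) ν u p := ⟨hcl, by rw [hu0]; exact hdec, hE⟩
      obtain ⟨M, hM⟩ := hbd Ts hTs u p hloc hu0
      -- hence its BKM integral is finite
      have hfin : (∫⁻ t in Ioo 0 Ts, ⨆ x, ‖curl (u t) x‖ₑ) < ⊤ := by
        have hle : (∫⁻ t in Ioo 0 Ts, ⨆ x, ‖curl (u t) x‖ₑ) ≤ ∫⁻ _t in Ioo 0 Ts, ENNReal.ofReal M := by
          refine MeasureTheory.setLIntegral_mono' measurableSet_Ioo fun t ht => iSup_le fun x => ?_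
          rw [← ofReal_norm]
          exact ENNReal.ofReal_le_ofReal (hM t (Ioo_subset_Ico_self ht) x)
        refine lt_of_le_of_lt hle ?_
        rw [MeasureTheory.setLIntegral_const]
        exact ENNReal.mul_lt_top ENNReal.ofReal_lt_top measure_Ioo_lt_top
      -- `u` is in the BKM class on closed sub-slabs (Tao 2013 Cor. 11.1): continue it past `T*`
      have hreg := ClayVariants.hasBoundedSobolevNormsOn_Icc_of_finiteEnergy_Ico hν hdec hcl hu0 hE
      obtain ⟨T', hT', u', p', hcl', hsob', hagr⟩ :=
        (beale_kato_majda_holds hν.le hTs hcl hreg).2 hfin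
      -- the continuation restricted to the CLOSED slab `[0, T*]` is finite-energy classical from `u₀`
      have hcl'' : IsClassicalNSSolutionOn (Icc 0 Ts) ν 0 u' p' :=
        hcl'.mono (Icc_subset_Ico_right hT') (uniqueDiffOn_Icc hTs)
      have hu'0 : u' 0 = u₀ := (hagr 0 ⟨le_rfl, hTs⟩).trans hu0
      obtain ⟨C, hC⟩ := hsob' 0
      refine hmax Ts le_rfl u' p' hcl'' hu'0 ⟨C, ENNReal.coe_lt_top, fun t ht => ?_⟩
      have h := hC t ht
      have h2 : ∀ x, ‖iteratedFDeriv ℝ 0 (u' t) x‖ₑ = ‖u' t x‖ₑ := fun x =>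
        enorm_eq_iff_norm_eq.2 norm_iteratedFDeriv_zero
      simp_rw [h2] at h
      exact h
  · -- periodic setting
    obtain ⟨hsm, hdiv, hper⟩ := hu₀
    have hsol : ClayVariants.clayPeriodic.Solvable ν 0 u₀ := by
      refine ClayVariants.clayPeriodic_solvable_of_aprioriCurlBound_datum hν hsm hdiv hper
        fun T u p hcl hu0 hperT => ?_
      rcases le_or_gt T 0 with hT | hT
      · exact ⟨0, fun t ht _ => absurd ht.2 (not_lt.2 (hT.trans ht.1))⟩
      · exact hbd T hT u p ⟨hcl, fun t ht => (hperT t ht).1, fun t ht => (hperT t ht).2⟩ hu0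
    obtain ⟨u, p, hu, hp, hns, hperg⟩ := (ClayVariants.clayPeriodic_solvable_zero_iff_errata ν u₀).1 hsol
    exact ⟨u, p, ⟨hu, hp, hns, hperg⟩⟩

/-- `BlowupExclusion` — `_holds` alias of `blowupExclusion_holds` above under the fact's exact name (appended
2026-08-28, D-0026 bookkeeping: the proof term is the existing theorem of this file; no statement,
definition or attribute is edited; no new named fact; the ledger's debt table listed the fact
unproved). [cite: Tao2011, Cor. 11.1 and Lemma 4.1 (ii) (arXiv:1108.1165)] -/
theorem _root_.Literature.Claims.NS.Polihronov2025.BlowupExclusion_holds : BlowupExclusion :=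
  _root_.Literature.Claims.NS.Polihronov2025.blowupExclusion_holds

end DebtPass

end Literature.Claims.NS.Polihronov2025

end

-- WHAT THIS IS NOT: not a claim about NS regularity or blow-up; not a claim about any author beyond the
-- typed locator.
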